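import Mathlib
import HarnessLib
import Literature.Geometry.Lorentzian.FinalEraPackage2
import Literature.Geometry.Lorentzian.BackgroundChartCalculusFramed
import Summits.FinalStateConjecture.FinalStateConjecture.Theorems.EIHFluxBalanceInertialRecessionLorentz
import Summits.FinalStateConjecture.FinalStateConjecture.Theorems.StarvedNecksFutureOrientedOfSeamedStubOneSign
import Summits.FinalStateConjecture.FinalStateConjecture.Theorems.StarvedNecksNeckGapDecayStubOrientationAnchorPastRay

/-!
# Route DissipativeFinalMotions — crux `FinalEraGeneric` (stmt-FinalStateConjecture-17642), line `registered`:
# orientation helpers for the stub `stub_orientationSpreads` (clause (F₀), the far flat zone)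

Elementary helpers for the far-zone flat orientation of a rev-2 final-era package
(`IsFinalEra₂`, FinalEraPackage2), used by `DissipativeFinalMotionsFinalEraGenericFlatFarOut` /
`…FlatOrientation`:

* `exists_free_direction` — Euclidean geometry of `E3`: among the `N + 1` spatial directions
  `w_k = e₁ + k e₂`, `k = 0, …, N`, one misses all `N` balls `B(cᵢ, ϱ)` along the whole line
  `p + r w_k` as soon as `‖p − cᵢ‖ ≥ (3 + 2N²) ϱ` for all `i` (two directions blocked by the same ball
  would differ by `< 2ϱ` at parameters `r` with `r² > 4(1 + N²)ϱ²`, impossible; pigeonhole);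
* `curve_lift` — the lift `Ψ ∘ c` of a smooth coordinate curve under a smooth chart map on an open
  `U ⊆ E4` and its velocity (chain rule through the inclusion `U ↪ E4`);
* pointwise extraction of a `C⁰` bound from a `Cᵏ` sup-norm bound (`norm_deviation_le_of_supCkENorm_le`),
  the cone algebra of a `C⁰`-pinched flat chart (`flat_cone_bounds`) for the coordinate vectors `∂₀` and
  `u = (1, v e)`, and the timecone handshake for past-directed vectors (`isPastDirected_of_val_lt_zero`).

References: B. O'Neill, *Semi-Riemannian geometry*, Academic Press 1983, Ch. 5, Lemma 5.26–5.29, p. 145;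
DHRT arXiv:2104.08222, §1 (pointwise norms of the metric deviation).
-/

noncomputable section

-- `<Problem> = <Summit>` doubles the namespace component (tree-wide convention)
set_option linter.dupNamespace false
-- instance search through nested operator types `E4 →L[ℝ] E4 →L[ℝ] ℝ`
set_option maxSynthPendingDepth 3

open Set Filter Topology Function
open scoped Manifold ContDiff ENNReal Topology
open Literature.Geometry.Lorentzian

namespace Summit.FinalStateConjecture.FinalStateConjecture.Theorems.DissipativeFinalMotions.FinalEraGeneric

/-! ## A free spatial direction away from `N` balls -/

/-- The candidate spatial directions `w_k = e₁ + k e₂ ∈ E3` (`k = 0, …, N`), as a local notation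
(no definition is introduced). [folklore] -/
local notation3 "dir" => fun (k : ℕ) ↦
  (EuclideanSpace.single (0 : Fin 3) (1 : ℝ) + (k : ℝ) • EuclideanSpace.single (1 : Fin 3) (1 : ℝ) : E3)

/-- Components of `w_k`: `(1, k, 0)`. [folklore] -/
theorem dir_apply (k : ℕ) : dir k 0 = 1 ∧ dir k 1 = k ∧ dir k 2 = 0 := by
  refine ⟨?_, ?_, ?_⟩ <;> simp

/-- `1 ≤ ‖w_k‖` (its first component is `1`). [folklore] -/
theorem one_le_norm_dir (k : ℕ) : 1 ≤ ‖dir k‖ := by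
  have h := EuclideanSpace.real_norm_sq_eq (dir k)
  obtain ⟨h0, h1, h2⟩ := dir_apply k
  rw [Fin.sum_univ_three, h0, h1, h2] at h
  have hsq : 1 ≤ ‖dir k‖ ^ 2 := by rw [h]; nlinarith [sq_nonneg (k : ℝ)]
  nlinarith [norm_nonneg (dir k)]

/-- `‖r w_k‖² = r² (1 + k²)`. [folklore] -/
theorem norm_smul_dir_sq (r : ℝ) (k : ℕ) : ‖r • dir k‖ ^ 2 = r ^ 2 * (1 + (k : ℝ) ^ 2) := by
  have h := EuclideanSpace.real_norm_sq_eq (r • dir k)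
  obtain ⟨h0, h1, h2⟩ := dir_apply k
  simp only [PiLp.smul_apply, smul_eq_mul, Fin.sum_univ_three, h0, h1, h2] at h
  rw [h]; ring

/-- `‖r w_k − r' w_l‖² = (r − r')² + (r k − r' l)²`. [folklore] -/
theorem norm_smul_dir_sub_sq (r r' : ℝ) (k l : ℕ) :
    ‖r • dir k - r' • dir l‖ ^ 2 = (r - r') ^ 2 + (r * k - r' * l) ^ 2 := by
  have h := EuclideanSpace.real_norm_sq_eq (r • dir k - r' • dir l)
  obtain ⟨h0, h1, h2⟩ := dir_apply k
  obtain ⟨h0', h1', h2'⟩ := dir_apply l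
  simp only [PiLp.sub_apply, PiLp.smul_apply, smul_eq_mul, Fin.sum_univ_three, h0, h1, h2, h0', h1',
    h2'] at h
  rw [h]; ring

/-- **Two directions blocked by one ball coincide.** If the rays `p + r w_k` and `p + r' w_l`
(`r, r' ≥ 0`, `k, l ≤ N`) both enter the ball `B(c, ϱ)` while `‖p − c‖ ≥ (3 + 2N²) ϱ`, then `k = l`:
the two ray points differ by `< 2ϱ`, the parameters exceed `2(1 + N²)^{1/2} ϱ`, and
`(1 + l²) ‖r w_k − r' w_l‖² ≥ r² (k − l)²`. [folklore] -/
theorem dir_eq_of_blocked {N : ℕ} {p c : E3} {ϱ : ℝ} {k l : ℕ} (hk : k ≤ N) (hl : l ≤ N)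
    (hpc : (3 + 2 * (N : ℝ) ^ 2) * ϱ ≤ ‖p - c‖) {r r' : ℝ}
    (hr : ‖p + r • dir k - c‖ < ϱ) (hr' : ‖p + r' • dir l - c‖ < ϱ) : k = l := by
  by_contra hne
  set K : ℝ := 1 + (N : ℝ) ^ 2 with hK
  have hK1 : 1 ≤ K := by rw [hK]; nlinarith [sq_nonneg (N : ℝ)]
  have hkN : (k : ℝ) ^ 2 ≤ (N : ℝ) ^ 2 := by
    have : (k : ℝ) ≤ N := by exact_mod_cast hk
    exact pow_le_pow_left₀ (Nat.cast_nonneg k) this 2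
  have hlN : (l : ℝ) ^ 2 ≤ (N : ℝ) ^ 2 := by
    have : (l : ℝ) ≤ N := by exact_mod_cast hl
    exact pow_le_pow_left₀ (Nat.cast_nonneg l) this 2
  have hϱ : 0 < ϱ := (norm_nonneg _).trans_lt hr
  -- the two ray points differ by `< 2ϱ`
  have hAB : ‖r • dir k - r' • dir l‖ < 2 * ϱ := by
    have h := norm_sub_le (p + r • dir k - c) (p + r' • dir l - c)
    have he : p + r • dir k - c - (p + r' • dir l - c) = r • dir k - r' • dir l := by abel
    rw [he] at h
    linarith
  -- the parameter `r` is large: `r² (1 + k²) > (2Kϱ)²`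
  have hrk : 2 * K * ϱ < ‖r • dir k‖ := by
    have h := norm_add_le (p + r • dir k - c) (-(r • dir k))
    have he : p + r • dir k - c + -(r • dir k) = p - c := by abel
    rw [he, norm_neg] at h
    have h3 : (3 + 2 * (N : ℝ) ^ 2) * ϱ = 2 * K * ϱ + ϱ := by rw [hK]; ring
    linarith
  have hr2 : 4 * K * ϱ ^ 2 < r ^ 2 := by
    have h0 : 0 ≤ 2 * K * ϱ := by positivity
    have h1 : (2 * K * ϱ) ^ 2 < ‖r • dir k‖ ^ 2 := pow_lt_pow_left₀ hrk h0 two_ne_zero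
    rw [norm_smul_dir_sq] at h1
    have h2 : r ^ 2 * (1 + (k : ℝ) ^ 2) ≤ r ^ 2 * K := by
      rw [hK]; exact mul_le_mul_of_nonneg_left (by linarith) (sq_nonneg r)
    nlinarith
  -- `(1 + l²) ‖r w_k − r' w_l‖² ≥ r² (k − l)² ≥ r²`
  have hkl : 1 ≤ ((k : ℝ) - l) ^ 2 := by
    have hz : (1 : ℤ) ≤ ((k : ℤ) - l) ^ 2 := by
      have hne' : (k : ℤ) - l ≠ 0 := by
        intro h; exact hne (by exact_mod_cast sub_eq_zero.mp h)
      nlinarith [sq_pos_of_ne_zero hne']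
    exact_mod_cast hz
  have hlow : r ^ 2 ≤ (1 + (l : ℝ) ^ 2) * ‖r • dir k - r' • dir l‖ ^ 2 := by
    rw [norm_smul_dir_sub_sq]
    have hid : (1 + (l : ℝ) ^ 2) * ((r - r') ^ 2 + (r * k - r' * l) ^ 2) =
        r ^ 2 * ((k : ℝ) - l) ^ 2 + ((1 + (l : ℝ) ^ 2) * r' - r * (1 + k * l)) ^ 2 := by ring
    rw [hid]
    nlinarith [sq_nonneg ((1 + (l : ℝ) ^ 2) * r' - r * (1 + k * l)), sq_nonneg r]
  have hup : (1 + (l : ℝ) ^ 2) * ‖r • dir k - r' • dir l‖ ^ 2 < K * (2 * ϱ) ^ 2 := by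
    have h1 : ‖r • dir k - r' • dir l‖ ^ 2 < (2 * ϱ) ^ 2 :=
      pow_lt_pow_left₀ hAB (norm_nonneg _) two_ne_zero
    have h2 : (1 + (l : ℝ) ^ 2) ≤ K := by rw [hK]; linarith
    calc (1 + (l : ℝ) ^ 2) * ‖r • dir k - r' • dir l‖ ^ 2
        ≤ K * ‖r • dir k - r' • dir l‖ ^ 2 := mul_le_mul_of_nonneg_right h2 (sq_nonneg _)
      _ < K * (2 * ϱ) ^ 2 := mul_lt_mul_of_pos_left h1 (by positivity)
  nlinarith

/-- **A free direction.** Given `N` centres `cᵢ ∈ E3`, a radius `ϱ` and a point `p` with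
`‖p − cᵢ‖ ≥ (3 + 2N²) ϱ` for all `i`, one of the `N + 1` directions `w_k = e₁ + k e₂` (`k ≤ N`) has its
whole ray `p + r w_k`, `r ≥ 0` (indeed `r ∈ ℝ`), at distance `≥ ϱ` from every centre (each ball blocks at
most one candidate, `dir_eq_of_blocked`; pigeonhole on `Fin (N + 1) → Fin N`). [folklore] -/
theorem exists_free_direction (N : ℕ) (c : Fin N → E3) (p : E3) (ϱ : ℝ)
    (hp : ∀ i, (3 + 2 * (N : ℝ) ^ 2) * ϱ ≤ ‖p - c i‖) :
    ∃ w : E3, 1 ≤ ‖w‖ ∧ ∀ i (r : ℝ), ϱ ≤ ‖p + r • w - c i‖ := by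
  by_contra hcon
  push Not at hcon
  have hbad : ∀ k : Fin (N + 1), ∃ i : Fin N, ∃ r : ℝ, ‖p + r • dir k - c i‖ < ϱ := fun k ↦ by
    obtain ⟨i, r, h⟩ := hcon (dir k) (one_le_norm_dir k)
    exact ⟨i, r, h⟩
  choose f hf using hbad
  have hinj : Injective f := by
    intro k l hkl
    obtain ⟨r, hr⟩ := hf k
    obtain ⟨r', hr'⟩ := hf l
    rw [hkl] at hr
    have h := dir_eq_of_blocked (Nat.lt_succ_iff.mp k.2) (Nat.lt_succ_iff.mp l.2) (hp (f l)) hr hr'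
    exact Fin.ext h
  have hcard := Fintype.card_le_of_injective f hinj
  simp only [Fintype.card_fin] at hcard
  omega

/-- **Registered stub `stub_freeDirection` (free spatial direction away from `N` balls)**: given `N`
centres `cᵢ ∈ ℝ³`, a radius `ϱ` and a point `p` with `‖p − cᵢ‖ ≥ (3 + 2N²) ϱ` for all `i`, some direction `w`
with `‖w‖ ≥ 1` has its whole line `p + r w` at distance `≥ ϱ` from every centre (`exists_free_direction`).
[folklore] -/
theorem stub_freeDirection : ∀ (N : ℕ) (c : Fin N → EuclideanSpace ℝ (Fin 3)) (p : EuclideanSpace ℝ (Fin 3)) (ϱ : ℝ), (∀ i, (3 + 2 * (N : ℝ) ^ 2) * ϱ ≤ ‖p - c i‖) → ∃ w : EuclideanSpace ℝ (Fin 3), 1 ≤ ‖w‖ ∧ ∀ i (r : ℝ), ϱ ≤ ‖p + r • w - c i‖ :=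
  exists_free_direction

/-! ## Lifting coordinate curves under a chart map -/

/-- Chain rule for velocities: `(f ∘ γ)'(t) = df_{γ t}(γ' t)`. [folklore] -/
theorem velocity_comp {E' : Type*} [NormedAddCommGroup E'] [NormedSpace ℝ E']
    {H' : Type*} [TopologicalSpace H'] {I' : ModelWithCorners ℝ E' H'} {N : Type*}
    [TopologicalSpace N] [ChartedSpace H' N]
    {E : Type*} [NormedAddCommGroup E] [NormedSpace ℝ E] {H : Type*} [TopologicalSpace H]
    {I : ModelWithCorners ℝ E H} {M : Type*} [TopologicalSpace M] [ChartedSpace H M]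
    {f : N → M} {γ : ℝ → N} {t : ℝ} (hf : MDifferentiableAt I' I f (γ t))
    (hγ : MDifferentiableAt 𝓘(ℝ, ℝ) I' γ t) :
    velocity I (f ∘ γ) t = mfderiv I' I f (γ t) (velocity I' γ t) := by
  -- adapted from `velocity_comp'` (StarvedNecksNeckGapDecayStubOrientationAnchor)
  simp only [velocity]
  rw [mfderiv_comp t hf hγ]
  rfl

/-- The velocity of a coordinate curve `q : ℝ → E4` (as a curve in the manifold `E4`) is its
derivative. [folklore] -/
theorem velocity_eq_of_hasDerivAt {q : ℝ → E4} {q' : E4} {t : ℝ} (hq : HasDerivAt q q' t) :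
    velocity 𝓘(ℝ, E4) q t = q' := by
  simp only [velocity]
  rw [mfderiv_eq_fderiv, hq.hasFDerivAt.fderiv]
  exact one_smul ℝ q'

/-- **The lift of a smooth coordinate curve and its velocity.** For a smooth chart map
`Ψ : U → 𝓢` on an open `U ⊆ E4` and a curve `c : ℝ → U` whose underlying `E4`-curve is the smooth
curve `q` with derivative `q'`, the lift `Ψ ∘ c` is smooth and its velocity at `t` is `dΨ_{c t}(q' t)`
(chain rule; the inclusion `U ↪ E4` has identity differential, `mfderiv_subtypeVal`). [folklore] -/
theorem curve_lift {𝓢 : Spacetime.{0} 4} {U : TopologicalSpace.Opens E4}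
    {Ψ : U → 𝓢.carrier} (hΨ : ContMDiff 𝓘(ℝ, E4) (𝓡 4) ∞ Ψ) {q q' : ℝ → E4}
    (hq : ContDiff ℝ ∞ q) (hq' : ∀ t, HasDerivAt q (q' t) t) {c : ℝ → U}
    (hc : ∀ s : ℝ, (c s : E4) = q s) :
    ContMDiff 𝓘(ℝ, ℝ) (𝓡 4) ∞ (Ψ ∘ c) ∧ ∀ t : ℝ, MDifferentiableAt 𝓘(ℝ, ℝ) (𝓡 4) (Ψ ∘ c) t ∧
      velocity (𝓡 4) (Ψ ∘ c) t = mfderiv 𝓘(ℝ, E4) (𝓡 4) Ψ (c t) (q' t) := by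
  -- adapted from `line_lift` (StarvedNecksNeckGapDecayStubOrientationAnchor): line ↦ smooth curve
  have hcv : Subtype.val ∘ c = q := funext hc
  have hp_smooth : ContMDiff 𝓘(ℝ, ℝ) 𝓘(ℝ, E4) ∞ q := contMDiff_iff_contDiff.mpr hq
  have hc_smooth : ContMDiff 𝓘(ℝ, ℝ) 𝓘(ℝ, E4) ∞ c :=
    (ContMDiff.subtypeVal_comp_iff U c).mp (hcv ▸ hp_smooth)
  have hγ : ContMDiff 𝓘(ℝ, ℝ) (𝓡 4) ∞ (Ψ ∘ c) := hΨ.comp hc_smooth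
  refine ⟨hγ, fun t ↦ ⟨hγ.mdifferentiableAt (by simp), ?_⟩⟩
  have hct : MDifferentiableAt 𝓘(ℝ, ℝ) 𝓘(ℝ, E4) c t := hc_smooth.mdifferentiableAt (by simp)
  have hΨt : MDifferentiableAt 𝓘(ℝ, E4) (𝓡 4) Ψ (c t) := hΨ.mdifferentiableAt (by simp)
  have hvc : velocity 𝓘(ℝ, E4) c t = q' t := by
    have h1 : velocity 𝓘(ℝ, E4) (Subtype.val ∘ c) t =
        mfderiv 𝓘(ℝ, E4) 𝓘(ℝ, E4) (Subtype.val : U → E4) (c t) (velocity 𝓘(ℝ, E4) c t) :=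
      velocity_comp (hasMFDerivAt_subtypeVal (c t)).mdifferentiableAt hct
    rw [mfderiv_subtypeVal, hcv, velocity_eq_of_hasDerivAt (hq' t)] at h1
    exact h1.symm
  rw [velocity_comp hΨt hct, hvc]

/-! ## Pointwise extraction and cone algebra of a pinched flat chart -/

/-- **Pointwise `C⁰` bound from a `Cᵏ` sup-norm bound**: if the `Cᵏ` sup norm of the extended
deviation over `S ⊆ B.domain` is `≤ δ` (`0 ≤ δ`), then `‖(Ψ^* g − g_B)(x)‖ ≤ δ` at every `x ∈ S` (the
`m = 0` term at `x`; `norm_iteratedFDeriv_zero`, `deviationExtend_coe`). DHRT arXiv:2104.08222, §1.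
[folklore] -/
theorem norm_deviation_le_of_supCkENorm_le (𝓢 : Spacetime.{0} 4) (B : ModelBackground)
    (Ψ : B.domain → 𝓢.carrier) {S : Set B.domain} {k : ℕ} {δ : ℝ} (hδ : 0 ≤ δ)
    (h : supCkENorm (Subtype.val '' S) k (𝓢.deviationExtend B Ψ) ≤ ENNReal.ofReal δ)
    (x : B.domain) (hx : x ∈ S) : ‖𝓢.deviation B Ψ x‖ ≤ δ := by
  -- adapted from `norm_deviation_le_of_truncDeviationCk_le` (StarvedNecksNeckGapDecayStubOrientationAnchor)
  have hmem : x.1 ∈ Subtype.val '' S := mem_image_of_mem _ hx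
  have h1 := enorm_iteratedFDeriv_le_supCkENorm (Nat.zero_le k) hmem (𝓢.deviationExtend B Ψ)
  have h2 : ‖iteratedFDeriv ℝ 0 (𝓢.deviationExtend B Ψ) x.1‖ₑ ≤ ENNReal.ofReal δ := h1.trans h
  rw [← ofReal_norm, norm_iteratedFDeriv_zero, Spacetime.deviationExtend_coe,
    ENNReal.ofReal_le_ofReal_iff hδ] at h2
  exact h2

/-- **Pushed-forward scalar products under a `C⁰` deviation bound**:
`g(dΨ v, dΨ w) ≤ g_B(v, w) + ‖(Ψ^* g − g_B)(z)‖ ‖v‖ ‖w‖` (`Spacetime.deviation_apply`,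
`ContinuousLinearMap.le_opNorm₂`). O'Neill 1983, Ch. 5, Lemma 5.26 (use). [folklore] -/
theorem val_mfderiv_le (𝓢 : Spacetime.{0} 4) (B : ModelBackground) (Ψ : B.domain → 𝓢.carrier)
    (z : B.domain) (v w : E4) :
    𝓢.metric.val (Ψ z) (mfderiv 𝓘(ℝ, E4) (𝓡 4) Ψ z v) (mfderiv 𝓘(ℝ, E4) (𝓡 4) Ψ z w) ≤
      B.bilin z.1 v w + ‖𝓢.deviation B Ψ z‖ * ‖v‖ * ‖w‖ := by
  have happ := 𝓢.deviation_apply B Ψ z v w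
  have hle : 𝓢.deviation B Ψ z v w ≤ ‖𝓢.deviation B Ψ z‖ * ‖v‖ * ‖w‖ :=
    (Real.le_norm_self _).trans ((𝓢.deviation B Ψ z).le_opNorm₂ v w)
  linarith

/-- **The tangent `u = (1, v e)` of a worldline receding at speed `v` in the unit direction `e`**:
`u⁰ = 1`, `‖u‖² = 1 + v²`, `η(u, u) = −1 + v²`. O'Neill 1983, Ch. 5, p. 145. [folklore] -/
theorem receding_tangent (v : ℝ) {e : E3} (he : ‖e‖ = 1) :
    E4.ofTimeSpace 1 (v • e) 0 = 1 ∧ ‖E4.ofTimeSpace 1 (v • e)‖ ^ 2 = 1 + v ^ 2 ∧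
      Minkowski.bilin (E4.ofTimeSpace 1 (v • e)) (E4.ofTimeSpace 1 (v • e)) = -1 + v ^ 2 := by
  have hn : E4.spatialNorm (E4.ofTimeSpace 1 (v • e)) ^ 2 = v ^ 2 := by
    rw [E4.spatialNorm_ofTimeSpace, norm_smul, he, mul_one, Real.norm_eq_abs, sq_abs]
  refine ⟨E4.ofTimeSpace_apply_zero 1 _, ?_, ?_⟩
  · rw [norm_sq_eq_sq_add_spatialNorm_sq, hn, E4.ofTimeSpace_apply_zero]; ring
  · rw [minkowski_bilin_self, hn, E4.ofTimeSpace_apply_zero]; ring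

/-- **Cone algebra of a pinched flat chart.** On the Minkowski background over `U`, at a point `z`
with `‖(Ψ^* g − η)(z)‖ ≤ ε` (`0 ≤ ε`), for the receding tangent `u = (1, v e)` (`‖e‖ = 1`,
`0 ≤ v`): `g(dΨ ∂₀, dΨ ∂₀) ≤ −1 + ε`, `g(dΨ u, dΨ u) ≤ −1 + v² + ε (1 + v²)` and
`g(dΨ ∂₀, dΨ u) ≤ −1 + ε (1 + v²)`. O'Neill 1983, Ch. 5, Lemma 5.26. [folklore] -/
theorem flat_cone_bounds (𝓢 : Spacetime.{0} 4) (U : TopologicalSpace.Opens E4)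
    (Ψ : (Minkowski.backgroundOn U).domain → 𝓢.carrier) (z : (Minkowski.backgroundOn U).domain)
    {ε : ℝ} (hε : 0 ≤ ε) (hdev : ‖𝓢.deviation (Minkowski.backgroundOn U) Ψ z‖ ≤ ε)
    (v : ℝ) {e : E3} (he : ‖e‖ = 1) :
    𝓢.metric.val (Ψ z) (mfderiv 𝓘(ℝ, E4) (𝓡 4) Ψ z (E4.basisVector 0))
        (mfderiv 𝓘(ℝ, E4) (𝓡 4) Ψ z (E4.basisVector 0)) ≤ -1 + ε ∧
      𝓢.metric.val (Ψ z) (mfderiv 𝓘(ℝ, E4) (𝓡 4) Ψ z (E4.ofTimeSpace 1 (v • e)))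
        (mfderiv 𝓘(ℝ, E4) (𝓡 4) Ψ z (E4.ofTimeSpace 1 (v • e))) ≤ -1 + v ^ 2 + ε * (1 + v ^ 2) ∧
      𝓢.metric.val (Ψ z) (mfderiv 𝓘(ℝ, E4) (𝓡 4) Ψ z (E4.basisVector 0))
        (mfderiv 𝓘(ℝ, E4) (𝓡 4) Ψ z (E4.ofTimeSpace 1 (v • e))) ≤ -1 + ε * (1 + v ^ 2) := by
  set u : E4 := E4.ofTimeSpace 1 (v • e) with hu
  obtain ⟨hu0, hun, huu⟩ := receding_tangent v he
  have he0 : ‖(E4.basisVector 0 : E4)‖ = 1 := by simp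
  have hd0 : 0 ≤ ‖𝓢.deviation (Minkowski.backgroundOn U) Ψ z‖ := norm_nonneg _
  have hun' : 0 ≤ ‖u‖ := norm_nonneg _
  have hu1 : 1 ≤ ‖u‖ := by nlinarith [sq_nonneg v]
  have hule : ‖u‖ ≤ 1 + v ^ 2 := by nlinarith
  refine ⟨?_, ?_, ?_⟩
  · have h := val_mfderiv_le 𝓢 (Minkowski.backgroundOn U) Ψ z (E4.basisVector 0) (E4.basisVector 0)
    have hb : (Minkowski.backgroundOn U).bilin z.1 (E4.basisVector 0) (E4.basisVector 0) = -1 :=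
      Minkowski.bilin_basisVector_zero
    rw [hb, he0, mul_one, mul_one] at h
    linarith
  · have h := val_mfderiv_le 𝓢 (Minkowski.backgroundOn U) Ψ z u u
    have hb : (Minkowski.backgroundOn U).bilin z.1 u u = -1 + v ^ 2 := huu
    rw [hb] at h
    have h2 : ‖𝓢.deviation (Minkowski.backgroundOn U) Ψ z‖ * ‖u‖ * ‖u‖ ≤ ε * (1 + v ^ 2) := by
      rw [mul_assoc, ← sq, hun]
      exact mul_le_mul_of_nonneg_right hdev (by positivity)
    linarith
  · have h := val_mfderiv_le 𝓢 (Minkowski.backgroundOn U) Ψ z (E4.basisVector 0) u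
    have hb : (Minkowski.backgroundOn U).bilin z.1 (E4.basisVector 0) u = -1 := by
      show Minkowski.bilin (E4.basisVector 0) u = -1
      rw [Minkowski.bilin_basisVector_zero_left, hu0]
    rw [hb, he0, mul_one] at h
    have h2 : ‖𝓢.deviation (Minkowski.backgroundOn U) Ψ z‖ * ‖u‖ ≤ ε * (1 + v ^ 2) :=
      mul_le_mul hdev hule hun' hε
    linarith

/-! ## Far-out late flat points are future-oriented (the receding ray) -/

/-- `2 ≤ ∞` in `ℕ∞ω` (regularity side condition of the causality theorems). [folklore] -/
theorem two_le_infty' : (2 : ℕ∞ω) ≤ (∞ : ℕ∞ω) := WithTop.coe_le_coe.mpr le_top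

/-- `1 ≤ ∞` in `ℕ∞ω`. [folklore] -/
theorem one_le_infty' : (1 : ℕ∞ω) ≤ (∞ : ℕ∞ω) := WithTop.coe_le_coe.mpr le_top

/-- Bilinearity: `g(c a, c b) = c² g(a, b)`. [folklore] -/
theorem val_smul_smul (𝓢 : Spacetime.{0} 4) (p : 𝓢.carrier) (c : ℝ)
    (a b : TangentSpace (𝓡 4) p) :
    𝓢.metric.val p (c • a) (c • b) = c * c * 𝓢.metric.val p a b := by
  simp only [map_smul, FunLike.coe_smul, Pi.smul_apply, smul_eq_mul]
  ring

/-- **A past-directed pinched coordinate vector hands its orientation to a nearby one.** If `a`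
is past-directed and timelike, `b` is causal and `g(a, b) < 0`, then `b` is past-directed (the
timecone lemma `TimeOrientation.isFutureDirected_of_val_lt_zero` for the reversed orientation;
O'Neill 1983, Ch. 5, Lemma 5.29, p. 145). [folklore] -/
theorem isPastDirected_of_val_lt_zero (𝓢 : Spacetime.{0} 4) {p : 𝓢.carrier}
    {a b : TangentSpace (𝓡 4) p} (ha : 𝓢.timeOrientation.IsPastDirected a)
    (hat : 𝓢.metric.IsTimelike a) (hb : 𝓢.metric.IsCausal b) (hab : 𝓢.metric.val p a b < 0) :
    𝓢.timeOrientation.IsPastDirected b := by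
  rw [← TimeOrientation.isFutureDirected_reverse_iff] at ha ⊢
  exact 𝓢.timeOrientation.reverse.isFutureDirected_of_val_lt_zero ha hat hb hab

end Summit.FinalStateConjecture.FinalStateConjecture.Theorems.DissipativeFinalMotions.FinalEraGeneric

end
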